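import Mathlib
import HarnessLib
import Literature.GroupTheory.CombinatorialGroupTheory.SignedHurwitzAction
import Summits.SmoothPoincare4.SmoothPoincare4.Theorems.ConvexBisectionAcyclicBisectionExistsStubSortBiSpan
import Literature.Uncategorized.StubModpOrbitWithoutOmegaConnected

/-!
# `OmegaConnected` is load-bearing in stub `stub_modpOrbit` (line `modp-braid-orbits`,
crux `ConvexBisection.AcyclicBisectionExists`, item stmt-SmoothPoincare4-10508)

Negative lemma (refuter, drefute): the finite engine `stub_modpOrbit` of the checked skeleton
`Cruxes/AcyclicBisectionExists/Lines/modp-braid-orbits.lean` becomes FALSE when its hypothesis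
`OmegaConnected (stdSymp (ZMod p) g) (letters (l₁ ++ l₂))` is deleted, for genus `g = 2` and every
prime `p ≡ 1 (mod 4)` (hence for arbitrarily large primes, so no threshold `p₀` helps).

Witness.  Let `i² = -1` in `𝔽_p` and `V = 𝔽_p² ⊕ 𝔽_p² = V₁ ⊥ V₂` (`V₁ = ⟨e₁, f₁⟩`,
`V₂ = ⟨e₂, f₂⟩`).  Since `T_{i•v} = T_v⁻¹`, the four POSITIVE letters `(f₁,+)(e₁,+)(i e₁,+)(i f₁,+)`
have monodromy `T_{f₁} T_{e₁} T_{e₁}⁻¹ T_{f₁}⁻¹ = 1`, and so do the four NEGATIVE letters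
`(i f₂,−)(i e₂,−)(e₂,−)(f₂,−)`.  Interleave them as
`l₁ = (f₁,+)(e₁,+)(i f₂,−)(i e₂,−)`, `l₂ = (i e₁,+)(i f₁,+)(e₂,−)(f₂,−)`: both halves are bases,
exactly `4 = 2g` letters are positive, and `wordProduct = 1` (letters of `V₁` commute with letters
of `V₂`).  Along the whole signed Hurwitz orbit every letter stays in `V₁ ∪ V₂` and every POSITIVE
letter stays in `V₁` (a move between a `V₁`-letter and a `V₂`-letter is a plain swap because
`ω(V₁, V₂) = 0`; signs travel with letters), so the positive classes never span `V`.

Moral for the line: the "one more common stabilisation pair making the letter set ω-connected"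
inside the dictionary stub `stub_sortedModel` is not cosmetic.  (For `p ≡ 3 (mod 4)`, `p ≥ 5`,
the same decomposable obstruction exists with four positive transvections of product one in
`SL(2,p)` obtained by conjugating `T_{e} T_{f}` — refuter evidence `stubs/stub_modpOrbit.md`; only the
`p ≡ 1 (mod 4)` family is formalised here, which already meets every threshold `p₀`.)
-/

noncomputable section

-- the prescribed namespace `Summit.<P>.<Sub>.…` duplicates `SmoothPoincare4` (P = Sub)
set_option linter.dupNamespace false

namespace Summit.SmoothPoincare4.SmoothPoincare4.Theorems.AcyclicBisectionExists.Negative.ModpOrbit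

open Literature.GroupTheory.CombinatorialGroupTheory.SignedHurwitz

section General

variable {R : Type*} [CommRing R] {V : Type*} [AddCommGroup V] [Module R V]
  (B : V →ₗ[R] V →ₗ[R] R)

/-- Transvections along mutually orthogonal classes commute. [folklore] -/
theorem transvection_comm {v w : V} (hvw : B v w = 0) (hwv : B w v = 0) (s t : Bool) :
    transvection B (v, s) * transvection B (w, t) = transvection B (w, t) * transvection B (v, s) := by
  apply LinearMap.ext
  intro y
  simp only [Module.End.mul_apply, transvection_apply, map_add, map_smul, hvw, hwv,
    mul_zero, zero_smul, add_zero]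
  abel

/-- Left-commutation form of `transvection_comm`. [folklore] -/
theorem transvection_left_comm {v w : V} (hvw : B v w = 0) (hwv : B w v = 0) (s t : Bool)
    (W : Module.End R V) :
    transvection B (v, s) * (transvection B (w, t) * W) =
      transvection B (w, t) * (transvection B (v, s) * W) := by
  rw [← mul_assoc, transvection_comm B hvw hwv, mul_assoc]

/-- A signed transvection along an isotropic class is inverted by flipping its sign. [folklore] -/
theorem transvection_mul_transvection_not {v : V} (hv : B v v = 0) (s : Bool) (W : Module.End R V) :
    transvection B (v, s) * (transvection B (v, !s) * W) = W := by
  rw [← mul_assoc]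
  suffices h : transvection B (v, s) * transvection B (v, !s) = 1 by rw [h, one_mul]
  apply LinearMap.ext
  intro y
  simp only [Module.End.mul_apply, transvection_apply, map_add, map_smul, hv,
    mul_zero, zero_smul, add_zero, Module.End.one_apply]
  cases s <;> simp [neg_smul]

/-- Rescaling a class by a square root of `-1` flips the sign of its transvection:
`T_{i•v}^{ε} = T_v^{-ε}`. [folklore] -/
theorem transvection_smul_of_sq_eq_neg_one {i : R} (hi : i * i = -1) (v : V) (s : Bool) :
    transvection B (i • v, s) = transvection B (v, !s) := by
  apply LinearMap.ext
  intro y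
  simp only [transvection_apply, map_smul, smul_eq_mul, LinearMap.smul_apply, smul_smul]
  congr 1
  have : sgn s * (i * B v y) * i = sgn (!s) * B v y := by
    have h2 : sgn s * (i * B v y) * i = (i * i) * (sgn s * B v y) := by ring
    rw [h2, hi]
    cases s <;> simp
  rw [this]

end General

/-! ## The decomposable witness over `𝔽_p`, `p ≡ 1 (mod 4)` -/

section Witness

variable {p : ℕ} [Fact p.Prime]

local notation "V" => (Fin 2 ⊕ Fin 2 → ZMod p)
local notation "ω" => stdSymp (ZMod p) 2

/-- Closed formula for the standard symplectic form in genus 2. [folklore] -/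
theorem stdSymp_two_apply (x y : V) :
    ω x y = x (Sum.inl 0) * y (Sum.inr 0) - x (Sum.inr 0) * y (Sum.inl 0) +
      (x (Sum.inl 1) * y (Sum.inr 1) - x (Sum.inr 1) * y (Sum.inl 1)) := by
  rw [ModpBraidOrbits.SortBiSpan.stdSymp_apply 2 x y, Fin.sum_univ_two]

/-- The standard symplectic form is alternating. [folklore] -/
theorem stdSymp_two_self (x : V) : ω x x = 0 :=
  ModpBraidOrbits.SortBiSpan.stdSymp_self 2 x

/-- First symplectic plane `V₁ = {x | x_{e₂} = 0 ∧ x_{f₂} = 0}`. [folklore] -/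
def V₁ : Submodule (ZMod p) V :=
  LinearMap.ker (LinearMap.proj (Sum.inl 1)) ⊓ LinearMap.ker (LinearMap.proj (Sum.inr 1))

/-- Second symplectic plane `V₂ = {x | x_{e₁} = 0 ∧ x_{f₁} = 0}`. [folklore] -/
def V₂ : Submodule (ZMod p) V :=
  LinearMap.ker (LinearMap.proj (Sum.inl 0)) ⊓ LinearMap.ker (LinearMap.proj (Sum.inr 0))

/-- Membership in `V₁`. [folklore] -/
theorem mem_V₁ {x : V} : x ∈ (V₁ : Submodule (ZMod p) V) ↔ x (Sum.inl 1) = 0 ∧ x (Sum.inr 1) = 0 := by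
  simp [V₁]

/-- Membership in `V₂`. [folklore] -/
theorem mem_V₂ {x : V} : x ∈ (V₂ : Submodule (ZMod p) V) ↔ x (Sum.inl 0) = 0 ∧ x (Sum.inr 0) = 0 := by
  simp [V₂]

/-- `V₁ ⊥ V₂`. [folklore] -/
theorem omega_V₁_V₂ {x y : V} (hx : x ∈ (V₁ : Submodule (ZMod p) V)) (hy : y ∈ (V₂ : Submodule (ZMod p) V)) :
    ω x y = 0 := by
  rw [mem_V₁] at hx; rw [mem_V₂] at hy
  rw [stdSymp_two_apply, hx.1, hx.2, hy.1, hy.2]; ring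

/-- `V₂ ⊥ V₁`. [folklore] -/
theorem omega_V₂_V₁ {x y : V} (hx : x ∈ (V₂ : Submodule (ZMod p) V)) (hy : y ∈ (V₁ : Submodule (ZMod p) V)) :
    ω x y = 0 := by
  rw [mem_V₂] at hx; rw [mem_V₁] at hy
  rw [stdSymp_two_apply, hx.1, hx.2, hy.1, hy.2]; ring

/-- The orbit invariant: every letter lies in `V₁` or in `V₂`, every positive letter in `V₁`. [folklore] -/
def Inv (l : List (V × Bool)) : Prop :=
  ∀ x ∈ l, (x.1 ∈ (V₁ : Submodule (ZMod p) V) ∨ x.1 ∈ (V₂ : Submodule (ZMod p) V)) ∧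
    (x.2 = true → x.1 ∈ (V₁ : Submodule (ZMod p) V))

/-- The new letter produced by a Hurwitz move from letters satisfying the invariant satisfies it:
generic form covering both `b + c•a` (`c = sgn · ω a b`) and `a - c•b`. [folklore] -/
theorem inv_newLetter {a b : V} {sb : Bool} (c : ZMod p)
    (ha : a ∈ (V₁ : Submodule (ZMod p) V) ∨ a ∈ (V₂ : Submodule (ZMod p) V))
    (hb : b ∈ (V₁ : Submodule (ZMod p) V) ∨ b ∈ (V₂ : Submodule (ZMod p) V))
    (hbpos : sb = true → b ∈ (V₁ : Submodule (ZMod p) V))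
    (hc : ω a b = 0 → c = 0) :
    ((b + c • a) ∈ (V₁ : Submodule (ZMod p) V) ∨ (b + c • a) ∈ (V₂ : Submodule (ZMod p) V)) ∧
      (sb = true → (b + c • a) ∈ (V₁ : Submodule (ZMod p) V)) := by
  rcases ha with ha | ha <;> rcases hb with hb | hb
  · exact ⟨Or.inl (add_mem hb (Submodule.smul_mem _ _ ha)), fun _ => add_mem hb (Submodule.smul_mem _ _ ha)⟩
  · have h0 : c = 0 := hc (omega_V₁_V₂ ha hb)
    subst h0
    simp only [zero_smul, add_zero]
    exact ⟨Or.inr hb, hbpos⟩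
  · have h0 : c = 0 := hc (omega_V₂_V₁ ha hb)
    subst h0
    simp only [zero_smul, add_zero]
    exact ⟨Or.inl hb, hbpos⟩
  · refine ⟨Or.inr (add_mem hb (Submodule.smul_mem _ _ ha)), fun hs => ?_⟩
    have hb1 := hbpos hs
    -- b ∈ V₁ ∩ V₂ = 0-coordinates everywhere, and then ω a b = 0 so c = 0
    have h0 : c = 0 := hc (omega_V₂_V₁ ha hb1)
    subst h0
    simpa using hb1

/-- One Hurwitz step preserves the invariant. [folklore] -/
theorem inv_step {l l' : List (V × Bool)} (h : HurwitzStep ω l l') (hl : Inv l) : Inv l' := by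
  obtain ⟨pre, suf, a, b, rfl, hl'⟩ := h
  have ha := hl a (by simp)
  have hb := hl b (by simp)
  intro x hx
  rcases hl' with rfl | rfl
  · simp only [List.mem_append, List.mem_cons] at hx
    rcases hx with hx | rfl | rfl | hx
    · exact hl x (by simp [hx])
    · exact inv_newLetter (sgn a.2 * ω a.1 b.1) ha.1 hb.1 hb.2 (fun h0 => by rw [h0, mul_zero])
    · exact ha
    · exact hl x (by simp [hx])
  · simp only [List.mem_append, List.mem_cons] at hx
    rcases hx with hx | rfl | rfl | hx
    · exact hl x (by simp [hx])
    · exact hb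
    · have := inv_newLetter (-(sgn b.2 * ω b.1 a.1)) hb.1 ha.1 ha.2 (fun h0 => by rw [h0, mul_zero, neg_zero])
      simpa [sub_eq_add_neg, neg_smul] using this
    · exact hl x (by simp [hx])

/-- The invariant propagates along the Hurwitz orbit. [folklore] -/
theorem inv_orbit {l l' : List (V × Bool)} (h : HurwitzOrbit ω l l') (hl : Inv l) : Inv l' := by
  induction h with
  | refl => exact hl
  | tail _ hstep ih => exact inv_step hstep ih

/-- Under the invariant the positive classes lie in `V₁`, hence do not span. [folklore] -/
theorem span_pos_ne_top {m : List (V × Bool)} (hm : Inv m) :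
    Submodule.span (ZMod p) (classesOfSign m true) ≠ ⊤ := by
  intro htop
  have hle : Submodule.span (ZMod p) (classesOfSign m true) ≤ V₁ :=
    Submodule.span_le.mpr fun v hv => (hm (v, true) hv).2 rfl
  have hmem : (Pi.single (Sum.inl 1) 1 : V) ∈ (V₁ : Submodule (ZMod p) V) := hle (htop ▸ Submodule.mem_top)
  rw [mem_V₁] at hmem
  simp at hmem

/-! ### The eight letters -/

/-- The coordinate vector `e₁`. [folklore] -/ def e₁ : V := Pi.single (Sum.inl 0) 1
/-- The coordinate vector `f₁`. [folklore] -/ def f₁ : V := Pi.single (Sum.inr 0) 1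
/-- The coordinate vector `e₂`. [folklore] -/ def e₂ : V := Pi.single (Sum.inl 1) 1
/-- The coordinate vector `f₂`. [folklore] -/ def f₂ : V := Pi.single (Sum.inr 1) 1

/-- `e₁ ∈ V₁`. [folklore] -/
theorem e₁_mem : (e₁ : V) ∈ (V₁ : Submodule (ZMod p) V) := by simp [mem_V₁, e₁]
/-- `f₁ ∈ V₁`. [folklore] -/
theorem f₁_mem : (f₁ : V) ∈ (V₁ : Submodule (ZMod p) V) := by simp [mem_V₁, f₁]
/-- `e₂ ∈ V₂`. [folklore] -/
theorem e₂_mem : (e₂ : V) ∈ (V₂ : Submodule (ZMod p) V) := by simp [mem_V₂, e₂]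
/-- `f₂ ∈ V₂`. [folklore] -/
theorem f₂_mem : (f₂ : V) ∈ (V₂ : Submodule (ZMod p) V) := by simp [mem_V₂, f₂]

variable (i : ZMod p)

/-- First half `(f₁,+)(e₁,+)(i f₂,−)(i e₂,−)` of the witness word. [folklore] -/
def l₁ : List (V × Bool) := [(f₁, true), (e₁, true), (i • f₂, false), (i • e₂, false)]

/-- Second half `(i e₁,+)(i f₁,+)(e₂,−)(f₂,−)` of the witness word. [folklore] -/
def l₂ : List (V × Bool) := [(i • e₁, true), (i • f₁, true), (e₂, false), (f₂, false)]

/-- The witness word satisfies the invariant. [folklore] -/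
theorem inv_l₁l₂ : Inv (l₁ i ++ l₂ i) := by
  intro x hx
  simp only [l₁, l₂, List.cons_append, List.nil_append, List.mem_cons, List.not_mem_nil, or_false] at hx
  rcases hx with rfl | rfl | rfl | rfl | rfl | rfl | rfl | rfl
  · exact ⟨Or.inl f₁_mem, fun _ => f₁_mem⟩
  · exact ⟨Or.inl e₁_mem, fun _ => e₁_mem⟩
  · exact ⟨Or.inr (Submodule.smul_mem _ _ f₂_mem), fun h => by simp at h⟩
  · exact ⟨Or.inr (Submodule.smul_mem _ _ e₂_mem), fun h => by simp at h⟩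
  · exact ⟨Or.inl (Submodule.smul_mem _ _ e₁_mem), fun _ => Submodule.smul_mem _ _ e₁_mem⟩
  · exact ⟨Or.inl (Submodule.smul_mem _ _ f₁_mem), fun _ => Submodule.smul_mem _ _ f₁_mem⟩
  · exact ⟨Or.inr e₂_mem, fun h => by simp at h⟩
  · exact ⟨Or.inr f₂_mem, fun h => by simp at h⟩

/-- A set whose span contains the four coordinate vectors spans. [folklore] -/
theorem span_eq_top_of_mem {S : Set V}
    (h1 : (e₁ : V) ∈ Submodule.span (ZMod p) S) (h2 : (f₁ : V) ∈ Submodule.span (ZMod p) S)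
    (h3 : (e₂ : V) ∈ Submodule.span (ZMod p) S) (h4 : (f₂ : V) ∈ Submodule.span (ZMod p) S) :
    Submodule.span (ZMod p) S = ⊤ := by
  apply top_unique
  rw [← (Pi.basisFun (ZMod p) (Fin 2 ⊕ Fin 2)).span_eq, Submodule.span_le]
  rintro _ ⟨j, rfl⟩
  rw [Pi.basisFun_apply]
  rcases j with j | j <;> fin_cases j
  · exact h1
  · exact h3
  · exact h2
  · exact h4

/-- `i • v ∈ span S ⇒ v ∈ span S` for `i² = −1`. [folklore] -/
theorem unsmul_mem {S : Set V} (hi : i * i = -1) {v : V} (h : i • v ∈ Submodule.span (ZMod p) S) :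
    v ∈ Submodule.span (ZMod p) S := by
  have := Submodule.smul_mem _ (-i) h
  rwa [smul_smul, neg_mul, hi, neg_neg, one_smul] at this

/-- The first half spans. [folklore] -/
theorem span_l₁ (hi : i * i = -1) : Submodule.span (ZMod p) (letters (l₁ i)) = ⊤ := by
  have mem : ∀ v s, (v, s) ∈ l₁ i → v ∈ Submodule.span (ZMod p) (letters (l₁ i)) :=
    fun v s h => Submodule.subset_span ⟨s, h⟩
  refine span_eq_top_of_mem (mem _ true ?_) (mem _ true ?_)
    (unsmul_mem i hi (mem _ false ?_)) (unsmul_mem i hi (mem _ false ?_)) <;> simp [l₁]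

/-- The second half spans. [folklore] -/
theorem span_l₂ (hi : i * i = -1) : Submodule.span (ZMod p) (letters (l₂ i)) = ⊤ := by
  have mem : ∀ v s, (v, s) ∈ l₂ i → v ∈ Submodule.span (ZMod p) (letters (l₂ i)) :=
    fun v s h => Submodule.subset_span ⟨s, h⟩
  refine span_eq_top_of_mem (unsmul_mem i hi (mem _ true ?_)) (unsmul_mem i hi (mem _ true ?_))
    (mem _ false ?_) (mem _ false ?_) <;> simp [l₂]

/-- The monodromy of the witness word is trivial. [folklore] -/
theorem wordProduct_l₁l₂ (hi : i * i = -1) : wordProduct ω (l₁ i ++ l₂ i) = 1 := by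
  have hself : ∀ x : V, ω x x = 0 := stdSymp_two_self
  -- rewrite the four `i`-letters as sign-flipped letters
  simp only [l₁, l₂, List.cons_append, List.nil_append, wordProduct_cons, wordProduct_nil,
    transvection_smul_of_sq_eq_neg_one ω hi, Bool.not_true, Bool.not_false]
  -- now: T f₁⁺ (T e₁⁺ (T f₂⁺ (T e₂⁺ (T e₁⁻ (T f₁⁻ (T e₂⁻ (T f₂⁻ 1)))))))
  have c1 : ∀ (s t : Bool) (W : Module.End (ZMod p) V),
      transvection ω (e₂, s) * (transvection ω (e₁, t) * W) = transvection ω (e₁, t) * (transvection ω (e₂, s) * W) :=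
    fun s t W => transvection_left_comm ω (omega_V₂_V₁ e₂_mem e₁_mem) (omega_V₁_V₂ e₁_mem e₂_mem) s t W
  have c2 : ∀ (s t : Bool) (W : Module.End (ZMod p) V),
      transvection ω (f₂, s) * (transvection ω (e₁, t) * W) = transvection ω (e₁, t) * (transvection ω (f₂, s) * W) :=
    fun s t W => transvection_left_comm ω (omega_V₂_V₁ f₂_mem e₁_mem) (omega_V₁_V₂ e₁_mem f₂_mem) s t W
  have c3 : ∀ (s t : Bool) (W : Module.End (ZMod p) V),
      transvection ω (e₂, s) * (transvection ω (f₁, t) * W) = transvection ω (f₁, t) * (transvection ω (e₂, s) * W) :=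
    fun s t W => transvection_left_comm ω (omega_V₂_V₁ e₂_mem f₁_mem) (omega_V₁_V₂ f₁_mem e₂_mem) s t W
  have c4 : ∀ (s t : Bool) (W : Module.End (ZMod p) V),
      transvection ω (f₂, s) * (transvection ω (f₁, t) * W) = transvection ω (f₁, t) * (transvection ω (f₂, s) * W) :=
    fun s t W => transvection_left_comm ω (omega_V₂_V₁ f₂_mem f₁_mem) (omega_V₁_V₂ f₁_mem f₂_mem) s t W
  rw [c1, c2]            -- move e₁⁻ left past e₂⁺ then f₂⁺
  rw [show transvection ω (e₁, true) * (transvection ω (e₁, false) * _) = _ from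
    transvection_mul_transvection_not ω (hself e₁) true _]
  rw [c3, c4]            -- move f₁⁻ left past e₂⁺ then f₂⁺
  rw [show transvection ω (f₁, true) * (transvection ω (f₁, false) * _) = _ from
    transvection_mul_transvection_not ω (hself f₁) true _]
  -- remaining: T f₂⁺ (T e₂⁺ (T e₂⁻ (T f₂⁻ 1))) = 1
  rw [show transvection ω (e₂, true) * (transvection ω (e₂, false) * _) = _ from
    transvection_mul_transvection_not ω (hself e₂) true _]
  rw [show transvection ω (f₂, true) * (transvection ω (f₂, false) * _) = _ from
    transvection_mul_transvection_not ω (hself f₂) true _]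

end Witness

/-- **`OmegaConnected` is load-bearing in `stub_modpOrbit`.**  With the ω-connectedness hypothesis
deleted the finite engine of line `modp-braid-orbits` is false: at genus `2`, for every prime
`p ≡ 1 (mod 4)` (which exceed any threshold `p₀`), the decomposable word
`(f₁,+)(e₁,+)(i f₂,−)(i e₂,−) ++ (i e₁,+)(i f₁,+)(e₂,−)(f₂,−)` (`i² = −1`) satisfies every other
hypothesis, while along its whole signed Hurwitz orbit all positive letters stay in the plane
`V₁ = ⟨e₁, f₁⟩`. [folklore] -/
theorem stub_modpOrbit_false_without_omegaConnected : ¬ Literature.Uncategorized.StubModpOrbitWithoutOmegaConnected := by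
  intro h
  obtain ⟨p₀, hp₀⟩ := h 2
  obtain ⟨p, hp, hlt, hmod⟩ := Nat.exists_prime_gt_modEq_one p₀ (by norm_num : (4 : ℕ) ≠ 0)
  haveI : Fact p.Prime := ⟨hp⟩
  have hmod' : p % 4 = 1 := by
    have h4 : (1 : ℕ) % 4 = 1 := by norm_num
    rw [Nat.ModEq, h4] at hmod
    exact hmod
  obtain ⟨i, hi⟩ : IsSquare (-1 : ZMod p) := ZMod.exists_sq_eq_neg_one_iff.mpr (by omega)
  have hi' : i * i = -1 := hi.symm
  obtain ⟨m, hm, hspan⟩ := hp₀ p hlt (l₁ i) (l₂ i) (by simp [l₁]) (by simp [l₂])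
    (by simp [l₁, l₂]) (span_l₁ i hi') (span_l₂ i hi') (wordProduct_l₁l₂ i hi')
  exact span_pos_ne_top (inv_orbit hm (inv_l₁l₂ i)) hspan

end Summit.SmoothPoincare4.SmoothPoincare4.Theorems.AcyclicBisectionExists.Negative.ModpOrbit

end
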